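import Literature.AlgebraicGeometry.Resolution.WeightedResolutionDatum
import Literature.AlgebraicGeometry.Resolution.BlowupPrincipalCharts
import Literature.AlgebraicGeometry.Resolution.IdealSheafLemmas
import Mathlib.AlgebraicGeometry.Morphisms.Smooth
import Mathlib.AlgebraicGeometry.Morphisms.Separated
import Mathlib.AlgebraicGeometry.Morphisms.QuasiCompact
import Mathlib.AlgebraicGeometry.Morphisms.Affine
import Mathlib.RingTheory.Smooth.Basic
import Mathlib.Algebra.Polynomial.Laurent
import HarnessLib

/-!
# Off the exceptional divisor the invariant of `(B₊(U), strict transform)` is the invariant downstairs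

Topic: `Summits/ResolutionOfSingularities/ResolutionOfSingularities/Theorems`. Stub
`stub_offExceptional` of the line `support-first-weights-second` of the crux
`Theses.WeightedInvariant.WeightedConstruction` (statement `stmt-ResolutionOfSingularities-0571`)
of the summit `Summit.ResolutionOfSingularities.ResolutionOfSingularities`: the OFF-EXCEPTIONAL
half of axiom `(iv)` of `WeightedResolutionDatum`
(`Literature/AlgebraicGeometry/Resolution/WeightedResolutionDatum.lean`), for ANY rating `inv` of
pairs that is functorial for smooth `k`-morphisms. Notation: `A = Γ(Y, U)`, `I = R.chartIdeals U`,
`E = A[t⁻¹, Iₙ tⁿ] = extReesAlgebra I ⊆ A[t, t⁻¹]`, `s = t⁻¹ = extReesAlgebra.tInv I`,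
`B = Spec E = affineCobordantBlowup I ⊇ B₊ = B ∖ Vert(B)` (Włodarczyk, arXiv:2203.03090, Def. 2.3.5).

* `isLocalization_away_tInv` — **the trivial cobordant blow-up**: `A[t, t⁻¹] = E[1/s]` (Def. 2.3.5:
  `B₋ = B ∖ V(t⁻¹) = X × 𝔾ₘ`); same proof as the tree's `cobordantAlgebra.isLocalization_away_s`;
* `map_strictTransform_laurent` — after inverting `s` the strict transform `σˢ(𝔞)` (the
  `s`-saturation of `𝔞 E`, 3.3.12) and the total transform `𝔞 E` agree;
* `isOpenImmersion_awayι`, `range_awayι`, `awayι_π`, `smooth_SpecMap_laurent` — `Spec A[t, t⁻¹] → B`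
  is an open immersion onto `D(s)` over the smooth `Spec A[t, t⁻¹] → Spec A`;
* `comap_idealSheaf_strictTransform_awayι` — on `Spec A[t, t⁻¹]` the ideal sheaf of `σˢ(𝔞)` is the
  inverse image of the ideal sheaf `𝔞~` of `Spec A`;
* `cobordantPlusι_not_mem_support` — a point of `B₊` off `V(s)` maps to a point of `Y` outside
  `V(Iₙ)` for some `n ≥ 1`, hence outside the support of `R`;
* `stub_offExceptional` — the stub (registered signature): at `b ∈ B₊(U)` with `s(b) ≠ 0`,
  `inv (B₊(U) → Spec k) X' b = inv f X (image of b)` — the open `W = B₊ ∩ D(s)` maps by an open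
  immersion into `Spec A[t, t⁻¹]`, so `W → Y` is smooth, and on `W` the strict transform `X'` is the
  inverse image of `X` (`comap_fromSpec` of the tree identifies `X` on `Spec Γ(Y, U)`); functoriality
  of `inv` along the smooth legs `W → B₊(U)` and `W → Y` concludes — and the image of `b` is off the
  support of `R`.

## Sources

* J. Włodarczyk, *Functorial resolution by torus actions*, arXiv:2203.03090, Def. 2.3.5, 3.3.12,
  §3.3.33. [Wlodarczyk2022]
-/

noncomputable section

open CategoryTheory CategoryTheory.Limits AlgebraicGeometry TopologicalSpace
open Literature.AlgebraicGeometry.Resolution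
open LaurentPolynomial
open scoped LaurentPolynomial

-- the summit namespace repeats `ResolutionOfSingularities` by design
set_option linter.dupNamespace false

namespace Summit.ResolutionOfSingularities.ResolutionOfSingularities.Theorems

universe u

namespace OffExceptional

section Algebra

variable {A : Type u} [CommRing A] (I : ℕ → Ideal A)

/-! ## `A[t, t⁻¹] = A[t⁻¹, Iₙ tⁿ][t]` -/

/-- `(t⁻¹)ⁿ = t⁻ⁿ` in `A[t, t⁻¹]`. [folklore] -/
theorem coe_tInv_pow (n : ℕ) :
    ((extReesAlgebra.tInv I ^ n : extReesAlgebra I) : A[T;T⁻¹]) = T (-(n : ℤ)) := by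
  rw [SubmonoidClass.coe_pow, extReesAlgebra.coe_tInv, T_pow]
  congr 1
  ring

/-- `t⁻ⁿ ∈ A[t⁻¹, Iₙ tⁿ]` for `n ≥ 0`. [folklore] -/
theorem T_neg_natCast_mem (n : ℕ) : (T (-(n : ℤ)) : A[T;T⁻¹]) ∈ extReesAlgebra I := by
  rw [← coe_tInv_pow I n]
  exact (extReesAlgebra.tInv I ^ n).2

/-- `a t⁻ⁿ ∈ A[t⁻¹, Iₙ tⁿ]` for `a ∈ A`, `n ≥ 0`: `A[t⁻¹] ⊆ A[t⁻¹, Iₙ tⁿ]`. [folklore] -/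
theorem C_mul_T_neg_natCast_mem (a : A) (n : ℕ) :
    C a * T (-(n : ℤ)) ∈ extReesAlgebra I :=
  mul_mem (by rw [C_eq_algebraMap]; exact Subalgebra.algebraMap_mem _ a) (T_neg_natCast_mem I n)

-- adapted from `cobordantAlgebra.exists_mul_T_neg_mem` (CobordantBlowupAlgebra.lean)
/-- Every Laurent polynomial becomes an element of `A[t⁻¹] ⊆ A[t⁻¹, Iₙ tⁿ]` after multiplication
by a power of `t⁻¹`. [folklore] -/
theorem exists_mul_T_neg_mem (f : A[T;T⁻¹]) :
    ∃ n : ℕ, f * T (-(n : ℤ)) ∈ extReesAlgebra I := by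
  induction f using LaurentPolynomial.induction_on' with
  | add p q hp hq =>
    obtain ⟨m, hm⟩ := hp
    obtain ⟨n, hn⟩ := hq
    refine ⟨m + n, ?_⟩
    have e : (T (-((m + n : ℕ) : ℤ)) : A[T;T⁻¹]) = T (-(m : ℤ)) * T (-(n : ℤ)) := by
      rw [← T_add]; congr 1; push_cast; ring
    rw [add_mul, e, ← mul_assoc, mul_comm (T (-(m : ℤ))) (T (-(n : ℤ))), ← mul_assoc q]
    exact add_mem (mul_mem hm (T_neg_natCast_mem I n)) (mul_mem hn (T_neg_natCast_mem I m))
  | C_mul_T n a =>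
    refine ⟨n.toNat, ?_⟩
    rw [mul_assoc, ← T_add]
    have e : n + -((n.toNat : ℕ) : ℤ) = -(((n.toNat : ℤ) - n).toNat : ℤ) := by omega
    rw [e]
    exact C_mul_T_neg_natCast_mem I a _

-- adapted from `cobordantAlgebra.isLocalization_away_s` (CobordantBlowupAlgebra.lean)
/-- **The trivial cobordant blow-up** (Włodarczyk, Def. 2.3.5: `B₋ := B ∖ V(t⁻¹) = X × 𝔾ₘ`): the
Laurent polynomial ring `A[t, t⁻¹]` is the localisation of `A[t⁻¹, Iₙ tⁿ]` at `s = t⁻¹`.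
[cite: Wlodarczyk2022, Def. 2.3.5] -/
theorem isLocalization_away_tInv : IsLocalization.Away (extReesAlgebra.tInv I) A[T;T⁻¹] := by
  refine IsLocalization.Away.mk (extReesAlgebra.tInv I) ?_ ?_ ?_
  · exact isUnit_T (-1)
  · intro z
    obtain ⟨n, hn⟩ := exists_mul_T_neg_mem I z
    refine ⟨n, ⟨_, hn⟩, ?_⟩
    change z * (extReesAlgebra.tInv I ^ n : extReesAlgebra I).1 = z * T (-(n : ℤ))
    rw [coe_tInv_pow]
  · intro a b h
    exact ⟨0, by rw [pow_zero, one_mul, one_mul]; exact Subtype.ext h⟩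

/-- **Strict and total transform agree after inverting `t⁻¹`**: for an ideal `𝔞 ≤ A`, the
extensions to `A[t, t⁻¹]` of the strict transform `σˢ(𝔞) = {g | (t⁻¹)ᵐ g ∈ 𝔞 E}` (Włodarczyk
3.3.12) and of `𝔞 E` coincide, `t⁻¹` being a unit there. [cite: Wlodarczyk2022, 3.3.12] -/
theorem map_strictTransform_laurent (𝔞 : Ideal A) :
    (extReesAlgebra.strictTransform I 𝔞).map (algebraMap (extReesAlgebra I) A[T;T⁻¹]) =
      (𝔞.map (algebraMap A (extReesAlgebra I))).map (algebraMap (extReesAlgebra I) A[T;T⁻¹]) := by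
  haveI := isLocalization_away_tInv I
  apply le_antisymm
  · rw [Ideal.map_le_iff_le_comap]
    intro g hg
    obtain ⟨m, hm⟩ := (extReesAlgebra.mem_strictTransform_iff I).mp hg
    rw [Ideal.mem_comap]
    have hu : IsUnit (algebraMap (extReesAlgebra I) A[T;T⁻¹] (extReesAlgebra.tInv I ^ m)) := by
      rw [map_pow]
      exact (IsLocalization.Away.algebraMap_isUnit (S := A[T;T⁻¹]) (extReesAlgebra.tInv I)).pow m
    have hmem := Ideal.mem_map_of_mem (algebraMap (extReesAlgebra I) A[T;T⁻¹]) hm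
    rw [map_mul] at hmem
    exact (Ideal.unit_mul_mem_iff_mem _ hu).mp hmem
  · exact Ideal.map_mono (extReesAlgebra.map_le_strictTransform I 𝔞)

/-- `Spec A[t, t⁻¹] → Spec A` is smooth: `A[t, t⁻¹]` is the localisation at `X` of the polynomial
ring `A[X]`, and both steps are smooth algebras. [folklore] -/
theorem smooth_SpecMap_laurent (A : Type u) [CommRing A] :
    Smooth (Spec.map (CommRingCat.ofHom (algebraMap A A[T;T⁻¹]))) := by
  rw [HasRingHomProperty.Spec_iff (P := @Smooth), CommRingCat.hom_ofHom, RingHom.smooth_algebraMap]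
  haveI : Algebra.Smooth A (Polynomial A) := {}
  haveI : Algebra.Smooth (Polynomial A) A[T;T⁻¹] :=
    Algebra.Smooth.of_isLocalization_Away (Polynomial.X : Polynomial A)
  haveI : IsScalarTower A (Polynomial A) A[T;T⁻¹] := IsScalarTower.of_algebraMap_eq fun a => by
    rw [LaurentPolynomial.algebraMap_eq_toLaurent, Polynomial.algebraMap_apply, Algebra.algebraMap_self,
      RingHom.id_apply, Polynomial.toLaurent_C, C_eq_algebraMap]
  exact Algebra.Smooth.comp A (Polynomial A) A[T;T⁻¹]

/-! ## The open immersion `Spec A[t, t⁻¹] → B` onto `D(t⁻¹)` -/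

/-- `B₋ = Spec A[t, t⁻¹] → B = Spec A[t⁻¹, Iₙ tⁿ]` (the `Spec` of the inclusion) is an open immersion
(Włodarczyk, Def. 2.3.5: `B₋ = B ∖ V(t⁻¹)`). [cite: Wlodarczyk2022, Def. 2.3.5] -/
theorem isOpenImmersion_awayι :
    IsOpenImmersion (Spec.map (CommRingCat.ofHom (algebraMap (extReesAlgebra I) A[T;T⁻¹])) :
      Spec (.of A[T;T⁻¹]) ⟶ affineCobordantBlowup I) :=
  haveI := isLocalization_away_tInv I
  IsOpenImmersion.of_isLocalization (extReesAlgebra.tInv I)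

/-- The image of `B₋ = Spec A[t, t⁻¹]` in `B` is `D(t⁻¹)`. [cite: Wlodarczyk2022, Def. 2.3.5] -/
theorem range_awayι :
    Set.range (Spec.map (CommRingCat.ofHom (algebraMap (extReesAlgebra I) A[T;T⁻¹])) :
      Spec (.of A[T;T⁻¹]) ⟶ affineCobordantBlowup I) =
      (PrimeSpectrum.basicOpen (extReesAlgebra.tInv I) : Set (PrimeSpectrum (extReesAlgebra I))) :=
  haveI := isLocalization_away_tInv I
  PrimeSpectrum.localization_away_comap_range A[T;T⁻¹] (extReesAlgebra.tInv I)

/-- `Spec A[t, t⁻¹] → B → Spec A` is `Spec` of the structure map `A → A[t, t⁻¹]`. [folklore] -/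
theorem awayι_π :
    (Spec.map (CommRingCat.ofHom (algebraMap (extReesAlgebra I) A[T;T⁻¹])) :
      Spec (.of A[T;T⁻¹]) ⟶ affineCobordantBlowup I) ≫ affineCobordantBlowup.π I =
      Spec.map (CommRingCat.ofHom (algebraMap A A[T;T⁻¹])) := by
  rw [affineCobordantBlowup.π, ← Spec.map_comp, ← CommRingCat.ofHom_comp, ← IsScalarTower.algebraMap_eq]

/-- **On `B₋ = Spec A[t, t⁻¹]` the strict transform is the total transform**: the inverse images
along `Spec A[t, t⁻¹] → B` of the ideal sheaf of `σˢ(𝔞)` and of the inverse image of `𝔞~` along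
`B → Spec A` coincide (both are the ideal sheaf of `𝔞 · A[t, t⁻¹]`). [cite: Wlodarczyk2022, 3.3.12] -/
theorem comap_idealSheaf_strictTransform_awayι (𝔞 : Ideal A) :
    (affineCobordantBlowup.idealSheaf I (extReesAlgebra.strictTransform I 𝔞)).comap
        (Spec.map (CommRingCat.ofHom (algebraMap (extReesAlgebra I) A[T;T⁻¹])) :
          Spec (.of A[T;T⁻¹]) ⟶ affineCobordantBlowup I) =
      ((affineBlowup.idealSheaf 𝔞).comap (affineCobordantBlowup.π I)).comap
        (Spec.map (CommRingCat.ofHom (algebraMap (extReesAlgebra I) A[T;T⁻¹])) :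
          Spec (.of A[T;T⁻¹]) ⟶ affineCobordantBlowup I) := by
  rw [affineCobordantBlowup.idealSheaf, affineCobordantBlowup.π, affineBlowup.idealSheaf]
  unfold affineCobordantBlowup
  rw [comap_ofIdealTop_SpecMap, comap_ofIdealTop_SpecMap, comap_ofIdealTop_SpecMap,
    map_strictTransform_laurent]

/-! ## Supports -/

/-- The support of the ideal sheaf of `J ⊆ A[t⁻¹, Iₙ tⁿ]` on `B` is `V(J)`. [folklore] -/
theorem mem_support_idealSheaf_iff (J : Ideal (extReesAlgebra I)) (x : affineCobordantBlowup I) :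
    x ∈ (affineCobordantBlowup.idealSheaf I J).support ↔ J ≤ x.asIdeal := by
  have h : ((affineCobordantBlowup.idealSheaf I J).support : Set (affineCobordantBlowup I)) =
      PrimeSpectrum.zeroLocus (J : Set (extReesAlgebra I)) :=
    affineBlowup.support_idealSheaf J
  have hx : x ∈ ((affineCobordantBlowup.idealSheaf I J).support : Set (affineCobordantBlowup I)) ↔
      (J : Set (extReesAlgebra I)) ⊆ x.asIdeal := by
    rw [h]
    rfl
  exact hx.trans SetLike.coe_subset_coe

/-- `x ∈ B₊ ↔ (Iₙ tⁿ : n ≥ 1) ⊄ x`: `B₊` is the complement of the vertex.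
[cite: Wlodarczyk2022, Def. 2.3.5] -/
theorem mem_plusOpens_iff (x : affineCobordantBlowup I) :
    x ∈ affineCobordantBlowup.plusOpens I ↔ ¬ extReesAlgebra.vertexIdeal I ≤ x.asIdeal := by
  rw [← mem_support_idealSheaf_iff]
  rfl

/-- `x ∉ V(t⁻¹) ↔ t⁻¹ ∉ x`. [folklore] -/
theorem not_mem_support_exceptional_iff (x : affineCobordantBlowup I) :
    x ∉ (affineCobordantBlowup.exceptional I).support ↔ extReesAlgebra.tInv I ∉ x.asIdeal := by
  rw [affineCobordantBlowup.exceptional, mem_support_idealSheaf_iff, Ideal.span_le,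
    Set.singleton_subset_iff, SetLike.mem_coe]

/-- **Off the vertex and off `V(t⁻¹)` some `a ∈ Iₙ` (`n ≥ 1`) does not vanish**: at a point `x` of
`B₊ ∖ V(t⁻¹)` some generator `a tⁿ` of the vertex ideal and `t⁻¹` are both outside `x`, hence so is
`a = (a tⁿ)(t⁻¹)ⁿ`. [folklore] -/
theorem exists_algebraMap_not_mem {x : affineCobordantBlowup I}
    (hx : x ∈ affineCobordantBlowup.plusOpens I) (hs : extReesAlgebra.tInv I ∉ x.asIdeal) :
    ∃ n : ℕ, 0 < n ∧ ∃ a ∈ I n, algebraMap A (extReesAlgebra I) a ∉ x.asIdeal := by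
  rw [mem_plusOpens_iff, extReesAlgebra.vertexIdeal, Ideal.span_le, Set.not_subset] at hx
  obtain ⟨g, ⟨n, hn, a, ha, hg⟩, hgx⟩ := hx
  refine ⟨n, hn, a, ha, fun h => ?_⟩
  have e : algebraMap A (extReesAlgebra I) a = g * extReesAlgebra.tInv I ^ n := by
    apply Subtype.ext
    rw [MulMemClass.coe_mul, coe_tInv_pow, hg, Subalgebra.coe_algebraMap, ← C_eq_algebraMap,
      mul_T_assoc, add_neg_cancel, T_zero, mul_one]
  rw [e] at h
  rcases x.2.mem_or_mem h with h' | h'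
  · exact hgx h'
  · exact hs (x.2.mem_of_pow_mem n h')

end Algebra

/-! ## The image in `Y` of a point of `B₊(U)` off `V(t⁻¹)` is off the support of `R` -/

/-- For a Rees algebra `R` on a scheme `Y`, an affine open `U` and a point `b` of the cobordant
blow-up `B₊(U)` OFF the exceptional divisor `V(t⁻¹)`, the image of `b` in `Y` is not in the support
`⋂_{n ≥ 1} V(Rₙ)` of `R`: off the vertex some `a tⁿ` (`a ∈ Rₙ(U)`, `n ≥ 1`) is non-zero at `b`, and
so is `t⁻¹`, hence `a` is non-zero at the image point, which is then off `V(Rₙ)`.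
[cite: Wlodarczyk2022, Def. 2.3.5] -/
theorem cobordantPlusι_not_mem_support {Y : Scheme.{u}} (R : ReesAlgebraData Y)
    (U : Y.affineOpens) (b : R.cobordantPlus U)
    (hb : (affineCobordantBlowup.plusOpens (R.chartIdeals U)).ι b ∉
      ((affineCobordantBlowup.exceptional (R.chartIdeals U)).support :
        Set (affineCobordantBlowup (R.chartIdeals U)))) :
    R.cobordantPlusι U b ∉ R.support := by
  set I := R.chartIdeals U with hI
  have hx : (affineCobordantBlowup.plusOpens I).ι b ∈ affineCobordantBlowup.plusOpens I := by
    rw [Scheme.Opens.ι_apply]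
    exact b.2
  have hs : extReesAlgebra.tInv I ∉ ((affineCobordantBlowup.plusOpens I).ι b).asIdeal :=
    (not_mem_support_exceptional_iff I _).mp hb
  obtain ⟨n, hn, a, ha, hax⟩ := exists_algebraMap_not_mem I hx hs
  intro hmem
  have h1 := (R.mem_support_iff.mp hmem) n hn
  -- the image point is `U.fromSpec q` with `q = π(b)` a point of `Spec Γ(Y, U)`
  set q : Spec Γ(Y, U) :=
    affineCobordantBlowup.π I ((affineCobordantBlowup.plusOpens I).ι b) with hq
  have e : R.cobordantPlusι U b = U.2.fromSpec q := rfl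
  rw [e] at h1
  have hqU : U.2.fromSpec q ∈ (U : Y.Opens) := by
    rw [← SetLike.mem_coe, ← U.2.range_fromSpec]
    exact ⟨q, rfl⟩
  rw [Scheme.IdealSheafData.mem_support_iff_of_mem hqU] at h1
  have h2 : q ∈ U.2.fromSpec ⁻¹' Y.zeroLocus (U := U) ((R.piece n).ideal U) := h1
  rw [U.2.fromSpec_preimage_zeroLocus] at h2
  have h3 : a ∈ q.asIdeal := h2 ha
  exact hax h3

end OffExceptional

/-! ## The stub -/

open OffExceptional

/-- **Off the exceptional divisor, `inv` of the cobordant blow-up is `inv` downstairs** (stub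
`stub_offExceptional` of line `support-first-weights-second`, registered signature):
for any rating `inv` functorial for smooth `k`-morphisms (`k` perfect of characteristic `p`), any
Rees algebra `R` on a smooth separated quasi-compact `Y` over `k`, any affine chart `U` with
`B₊(U) → Spec k` smooth separated quasi-compact and any point `b` of `B₊(U)` off `V(t⁻¹)`, the
invariant of `(B₊(U), strict transform of X)` at `b` is the invariant of `(Y, X)` at the image of
`b`, and that image is off the support of `R` (Włodarczyk, Def. 2.3.5: `B ∖ V(t⁻¹) = X × 𝔾ₘ`, and
3.3.12: the strict transform is the schematic closure of the total transform off `V(t⁻¹)`).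
[cite: Wlodarczyk2022, Def. 2.3.5 and 3.3.12] -/
theorem stub_offExceptional :
    ∀ (p : ℕ) (Γ : Type) (inv : ∀ ⦃k : Type⦄ [Field k] ⦃Y : Scheme.{0}⦄, (Y ⟶ Spec (.of k)) →
      Y.IdealSheafData → Y → Γ),
    (∀ ⦃k : Type⦄ [Field k] [CharP k p] [PerfectField k] ⦃Y Y₁ : Scheme.{0}⦄ (f : Y ⟶ Spec (.of k))
      [Smooth f] [IsSeparated f] [QuasiCompact f] (f₁ : Y₁ ⟶ Spec (.of k)) [Smooth f₁] [IsSeparated f₁]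
      [QuasiCompact f₁] (g : Y₁ ⟶ Y) [Smooth g], g ≫ f = f₁ →
      ∀ (X : Y.IdealSheafData) (y₁ : Y₁), inv f₁ (X.comap g) y₁ = inv f X (g y₁)) →
    ∀ ⦃k : Type⦄ [Field k] [CharP k p] [PerfectField k] ⦃Y : Scheme.{0}⦄ (f : Y ⟶ Spec (.of k))
      [Smooth f] [IsSeparated f] [QuasiCompact f] (X : Y.IdealSheafData) (R : ReesAlgebraData Y)
      (U : Y.affineOpens), Smooth (R.cobordantPlusι U ≫ f) → IsSeparated (R.cobordantPlusι U ≫ f) →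
      QuasiCompact (R.cobordantPlusι U ≫ f) → ∀ b : R.cobordantPlus U,
      (affineCobordantBlowup.plusOpens (R.chartIdeals U)).ι b ∉
        ((affineCobordantBlowup.exceptional (R.chartIdeals U)).support :
          Set (affineCobordantBlowup (R.chartIdeals U))) →
      inv (R.cobordantPlusι U ≫ f) (R.cobordantStrictTransform U X) b = inv f X (R.cobordantPlusι U b) ∧
        R.cobordantPlusι U b ∉ R.support := by
  intro p Γ inv hcomap k _ _ _ Y f _ _ _ X R U hsm hsep hqc b hb
  refine ⟨?_, cobordantPlusι_not_mem_support R U b hb⟩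
  haveI := hsm
  haveI := hsep
  haveI := hqc
  -- notation: `E = Γ(U)[t⁻¹, Rₙ(U) tⁿ]`, `B = Spec E ⊇ B₊ = R.cobordantPlus U`, `s = t⁻¹`
  haveI : IsAffine (affineCobordantBlowup (R.chartIdeals U)) := by
    unfold affineCobordantBlowup
    infer_instance
  -- the open `W = B₊ ∩ D(s)` of `B₊` and its point `b`
  let ιp : R.cobordantPlus U ⟶ affineCobordantBlowup (R.chartIdeals U) :=
    (affineCobordantBlowup.plusOpens (R.chartIdeals U)).ι
  haveI : IsOpenImmersion ιp :=
    inferInstanceAs (IsOpenImmersion (affineCobordantBlowup.plusOpens (R.chartIdeals U)).ι)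
  let V : (affineCobordantBlowup (R.chartIdeals U)).Opens :=
    PrimeSpectrum.basicOpen (extReesAlgebra.tInv (R.chartIdeals U))
  let W : (R.cobordantPlus U).Opens := ιp ⁻¹ᵁ V
  have hbW : b ∈ W := by
    change extReesAlgebra.tInv (R.chartIdeals U) ∉
      ((affineCobordantBlowup.plusOpens (R.chartIdeals U)).ι b).asIdeal
    exact (not_mem_support_exceptional_iff (R.chartIdeals U) _).mp hb
  -- `W.ι` is quasi-compact: a base change of the affine `D(s) → B`
  have hV : IsAffineOpen V :=
    IsAffineOpen.Spec_basicOpen (R := .of (extReesAlgebra (R.chartIdeals U)))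
      (extReesAlgebra.tInv (R.chartIdeals U))
  haveI : IsAffine V := hV
  haveI : QuasiCompact W.ι :=
    MorphismProperty.of_isPullback (isPullback_morphismRestrict ιp V)
      (inferInstance : QuasiCompact V.ι)
  -- the open immersion `l : W → Spec Γ(U)[t, t⁻¹]` (lift through `D(s) = Spec Γ(U)[t, t⁻¹]`)
  let aw : Spec (.of Γ(Y, U)[T;T⁻¹]) ⟶ affineCobordantBlowup (R.chartIdeals U) :=
    Spec.map (CommRingCat.ofHom (algebraMap (extReesAlgebra (R.chartIdeals U)) Γ(Y, U)[T;T⁻¹]))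
  haveI : IsOpenImmersion aw := isOpenImmersion_awayι (R.chartIdeals U)
  have hrange : Set.range (W.ι ≫ ιp) ⊆ Set.range aw := by
    rintro _ ⟨w, rfl⟩
    rw [show Set.range aw = (V : Set (affineCobordantBlowup (R.chartIdeals U))) from
      range_awayι (R.chartIdeals U)]
    exact w.2
  obtain ⟨l, hl⟩ : ∃ l : (W : Scheme.{0}) ⟶ Spec (.of Γ(Y, U)[T;T⁻¹]), l ≫ aw = W.ι ≫ ιp :=
    ⟨IsOpenImmersion.lift aw (W.ι ≫ ιp) hrange, IsOpenImmersion.lift_fac aw (W.ι ≫ ιp) hrange⟩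
  haveI : IsOpenImmersion l := by
    have : IsOpenImmersion (l ≫ aw) := by
      rw [hl]
      infer_instance
    exact IsOpenImmersion.of_comp l aw
  -- `W → Y` factors as `W → Spec Γ(U)[t, t⁻¹] → Spec Γ(U) → Y`, hence is smooth
  have hfac : W.ι ≫ R.cobordantPlusι U =
      l ≫ Spec.map (CommRingCat.ofHom (algebraMap Γ(Y, U) Γ(Y, U)[T;T⁻¹])) ≫ U.2.fromSpec := by
    have e1 : R.cobordantPlusι U =
        (ιp ≫ affineCobordantBlowup.π (R.chartIdeals U)) ≫ U.2.fromSpec := rfl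
    rw [e1, ← awayι_π (R.chartIdeals U)]
    simp only [Category.assoc]
    rw [← Category.assoc, ← hl, Category.assoc]
    rfl
  haveI hsmg : Smooth (W.ι ≫ R.cobordantPlusι U) := by
    rw [hfac]
    haveI := smooth_SpecMap_laurent (Γ(Y, U) : Type)
    infer_instance
  -- on `W` the strict transform is the inverse image of `X`
  have hd : (R.cobordantStrictTransform U X).comap W.ι = X.comap (W.ι ≫ R.cobordantPlusι U) := by
    have e2 : R.cobordantStrictTransform U X =
        (affineCobordantBlowup.idealSheaf (R.chartIdeals U)
          (extReesAlgebra.strictTransform (R.chartIdeals U) (X.ideal U))).comap ιp := rfl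
    rw [e2, ← Scheme.IdealSheafData.comap_comp, ← hl, Scheme.IdealSheafData.comap_comp,
      comap_idealSheaf_strictTransform_awayι, hfac, Scheme.IdealSheafData.comap_comp,
      Scheme.IdealSheafData.comap_comp, comap_fromSpec, ← awayι_π (R.chartIdeals U),
      Scheme.IdealSheafData.comap_comp]
    rfl
  -- functoriality of `inv` along the two smooth legs `W → B₊` and `W → Y`
  have h1 := hcomap (R.cobordantPlusι U ≫ f) (W.ι ≫ (R.cobordantPlusι U ≫ f)) W.ι rfl
    (R.cobordantStrictTransform U X) ⟨b, hbW⟩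
  have h2 := hcomap f (W.ι ≫ (R.cobordantPlusι U ≫ f)) (W.ι ≫ R.cobordantPlusι U)
    (Category.assoc _ _ _) X ⟨b, hbW⟩
  rw [hd] at h1
  exact h1.symm.trans h2

end Summit.ResolutionOfSingularities.ResolutionOfSingularities.Theorems

end
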